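import Summits.QuantumFields.YangMills.Theses.UnitScaleTilt
import Literature.MathematicalPhysics.QuantumFieldTheory.Balaban1983to89.T3PrintedRegularMinimiser
import Literature.MathematicalPhysics.QuantumFieldTheory.Balaban1983to89.T3SmallLiftHistory
import Literature.MathematicalPhysics.QuantumFieldTheory.Balaban1983to89.T3AlphaInputsACTwoRun
import Summits.QuantumFields.YangMills.Theorems.UnitScaleTiltFluctuationComparisonRegPrOneStepSubmersion
import Summits.QuantumFields.YangMills.Theorems.UnitScaleTiltFluctuationComparisonRegPrSocket
import Summits.QuantumFields.YangMills.Theorems.AlphaInputsT3AC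
import Summits.QuantumFields.YangMills.Theorems.UnitScaleTiltFluctuationComparisonRegPrLevelCauchyMin
import Summits.QuantumFields.YangMills.Theorems.UnitScaleTiltFluctuationComparisonRegPrLevelCauchyMinT
import Summits.QuantumFields.YangMills.Theorems.UnitScaleTiltFluctuationComparisonRegPrAlphaTwoRunAdapterT
import Summits.QuantumFields.YangMills.Theorems.UnitScaleTiltFluctuationComparisonRegPrRepAtHeightsV3Fam
import Summits.QuantumFields.YangMills.Theorems.AlphaInputsT3ACv3Data
import Summits.QuantumFields.YangMills.Theorems.AlphaInputsT3ACv3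
import Summits.QuantumFields.YangMills.Theorems.UnitScaleTiltFluctuationComparisonRegPrGlobalSlackKernelEndToEnd
import Summits.QuantumFields.YangMills.Theorems.UnitScaleTiltFluctuationComparisonRegPrGlobalSlackOn
import Summits.QuantumFields.YangMills.Theorems.UnitScaleTiltFluctuationComparisonRegPrGlobalSlackBeta
import HarnessLib

/-!
# `Sketch_ideator1_g15` — F-idea1-g15-1: ERRATUM TO F-idea1-g14-1 (its rescaling covers the Ψ charts ONLY) AND THE TWO-PROFILE SLACK ROW
# (crux `FluctuationComparisonRegPr` stmt-QuantumFields-19201, ideator 1; bears on STUB 3⁗ of `FluctuationComparisonRegPrL` stmt-QuantumFields-19935,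
# skeletons v5j‴ `Lines/birth_v5j3.lean` / v5j⁗ `Lines/birth_v5j4.lean` — the STUB 3⁗ text is byte-identical in both)

Seat ym-cruxidea-19201-1, gen 15 (wake-only generation; trigger = ★slack pen's `REPORT-K1a-display-g0.md` v3: the Λc chart family G3D-07 is `g`-FREE,
`ChartAnalyticityAsCited (Ψ X) ρ (C63 · exp(−κ·dj X))`, and row 5 of the chain would need G3D-08 `N45`).  NOTHING in this file is an estimate on Bałaban's data,
a claim about the mass gap, or a registry write: every `def` is a HYPOTHESIS SCHEMA and every `theorem` is bookkeeping (0 `sorry`).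

## 0. ERRATUM (scope of F-idea1-g14-1)

`Sketch_ideator1_g14.lean` (`…Ideate1CollarPolylog`, tree sha16 196e545072150834) typed the honest rows with print's collar polylogarithm `r(g_b) = (1 + log g_b⁻¹)^{r₀}`
((28) p.263) and removed it by the scalar chart rescaling `Φ ↦ Φ∘(λ•)`, `B ↦ λ⁻¹B`, `λ = r(g_b)`, paid for by the factor `g_b` of the Ψ analyticity row G3D-01
(`C25·g_k·e^{−κ dj}`): `λ^d·g_b ≤ M(6r₀, 1)` (`collarW_pow_mul_gCo_le`).  Its `K1aLineHonest` hypothesises `ChartAnalyticGΦ D Φ κ ρ C_A (gCoFam F γ)` for the WHOLE chart family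
`Φ`.  For the lane's canonical family `Φ = canon = (Ψ, Λc)` (p533541 `…GlobalSlackCanonicalPolymers`, `newTerm = Re jet26(Ψ_X)(B) − far_X + Re jet26(Λc_X)(B) − farΛ_X`)
this hypothesis is FALSE AS A READING OF PRINT for the Λc half: G3D-07 is `g`-free (print p.265 L14–16, REPORT v3 §2).  Hence g14's rescaling removes the collar
polylogarithm for the Ψ charts only; for Λc the amplitude `λ^d·C63` is unbounded in `γ` (and `B` is ONE object evaluated by both families' jets, so it cannot be rescaled for Ψ alone).
The rest of g14 — the honest rows, `collarW_add_le`, the dilation algebra — stands, and so does its PORT `…GlobalSlackKernelRescale` (p536544, ★ym-ust-19935-slack g0); but the queued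
capstone `…GlobalSlackCanonicalEndToEndHonest` (`K1aChartLineHonest`: the six chart rows for ONE family `Φ` with `KernelSizeΦg`, ⟹ 3⁗ by rescaling, REPORT v4 §5) inherits the
restriction: its row `KernelSizeΦg D Φ κ C_E` (`‖ker‖ ≤ C_E·g_b·e^{−κ𝓛}`) is NOT derivable for the Λc members of the canonical family from any displayed row — a located gap of
the LINE (the capstone theorem itself is a correct implication).  Ways out, cheapest first: (i) an (α)-side answer that print's Λ-terms DO carry a factor `g_k` (then G3D-07's
amplitude should read `C63·g_k·e^{−κ dj}` and everything in g14/REPORT v4 §5 goes through) — a QUESTION for NODE O, not a letter; (ii) polylog-free configuration rows in print's LEG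
currency (43)×(44) (§3 below) — by name, registered 3⁗; (iii) the two-profile size currency of this file — one registry event of the pre-authorised kind (§4–§6).

## 1. DIAGNOSIS: the polylogarithm is a PROFILE SHIFT, and the window need not move with it

`θBal L γ b₀ p₀ i = g_i · b₀ (1 + log g_i⁻¹)^{p₀}` and `r(g_i)·θBal L γ b₀ p₀ i = θBal L γ b₀ (p₀ + r₀) i` EXACTLY (`θBal_add`, §1).  So every displayed size that
carries `r(g)·g·p(g)` — (28)'s `‖B‖ ≤ cB·r(g_k) g_k p(g_k)` (`rFun_mul_pFun`), the far terms' `g⁷(r p)⁷` (G3D-06/07; `far_currency`) — is a size at the SHIFTED profile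
`p₁ := p₀ + r₀`, written `θ′(i) := θBal L γ b₀ p₁ i`, while the small-field WINDOW (the region on which the rows are claimed, `PlaqSmall (θBal … b₀ p₀ n) V`) stays at the
record profile `p₀`.  Shifting `p₀` INSIDE the record instead (fork (I): `𝔠′.p₀ = p₀ + r₀`) is a regress — (28)'s polylog multiplies whatever profile defines the
region — so the two letters must be kept apart: WINDOW `p₀`, SIZES `p₁ ≥ p₀`.

## 2. MECHANISM (I″): THE TWO-PROFILE SLACK ROW `GlobalSupRateTSlack₂ D b₀ p₀ p₁ a σ C` (§2) and its consumer BY NAME (§3)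

`∃ c, ∀ K, ∀ n ≤ K, ∀ V, PlaqSmall (θBal b₀ p₀ n) V → |PintH (K+1) n V − PintH K n V − c K n| ≤ C·#Site·(θ′(n)²·L^{−a(K−n)} + θ′(n)^σ)` — the landed
`GlobalSlack.GlobalSupRateTSlack` (p523985) with the two size factors read at `p₁` (`slack₂_self_iff`: `p₁ = p₀` is the landed row, `Iff.rfl`; `slack₂_of_slack`: the landed
row implies it for every `p₁ ≥ p₀`, same constant — NOTHING PROVED FOR 3⁗ AS REGISTERED IS LOST; `slack₂_of_slack_wide`: so does the landed row at the wider profile `p₁`).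
CONSUMER-NEUTRAL: `cauchyAtHeights_of_globalSupRateTSlack₂[_seven]` = `GlobalSlack.cauchyAtHeights_of_windowBound` + `GlobalSlackOn.summable_slackRadii (p₀ := p₁)` +
`slackRadii_nonneg` + `θBal_le_geometric_sharp` (`c = 1/8`, `ρ = L^{−7/16}`) + `slack_ratio_lt_one` — five lines, `m₀ = ⌈(3+a)/a⌉ + 1` UNCHANGED (the consumer only ever
used that the radii are summable; the profile exponent never entered `m₀`).  Registered-shape slot: `levelCauchyOfGlobalSupRateTSlack₂_dec` (§3), `p₁` quantified per family
next to `σ, C`.  Relation to the β-door (`…GlobalSlackBeta.lean`, seat ym3-torus-p2 g14, RULING g20-№11 ADD. 2): that door re-weights the RATE half by `L^{βn}`; the polylogarithm sits in BOTH halves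
(`farΛ`'s `(rθ)⁷` is the slack half) and `r(g_n)⁷` is unbounded in `n ≤ K`, so no `K,n`-uniform constant moves it into `θ(n)^σ`, `σ ∈ ℕ`; the two doors commute and combine.

## 3. BIRTH-ROW DICTIONARY (§4): the three located (α)-letters are unnecessary at the birth level

With sizes at `p₁ = p₀ + r₀`: (28) is `‖B‖ ≤ cB·θ′` verbatim (`rFun_mul_pFun`; at birth co-height the index is `n+1`, and `θ′(n+1) ≤ θ′(n)` on the monotone window
`√γ ≤ e^{1−p₁}` exactly as the record chain already assumes at `p₀`; across levels `collarW_succ_le`: `r_{n+1} ≤ (1 + log L)^{r₀} r_n`); the far/farΛ currency `g⁷(rp)⁷` IS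
`θ′⁷` (`far_currency`; `σ = 7 ∈ ℕ`, the `g`-free amplitude `C63` is a constant); the Λc jet value `≤ C63(12/ρ)⁶e^{−κ𝓛}·Σ_{d=2}^{6}(cB·θ′)^d ≤ C_T·θ′²` WITHOUT G3D-08 `N45`.
So for the BIRTH rows neither the `r₀`-letter, nor `N45`, nor a far-power letter, nor g14's rescaling is needed.  OLD LEVELS (M1/M3/M5, undisplayed): the sup-currency
polylog there is `r(g_birth) = collarW(K−j) ≤ (1 + (u+1) log L)^{r₀}·collarW(n)` (`collarW_add_le`, `u` = levels since birth), NOT `≤ const·collarW(n)`: in two-profile currency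
the old-level rows carry the LEVEL WEIGHT `ω(u) = (1 + (u+1) log L)^{r₀}` next to the record's `x² = L^{−2u}` — summable against the `d ≥ 2` counting margin (`x⁴·L^{3u} = L^{−u}`), so the
chain's level sums survive with `ω`, but its rows/proofs must be re-run with `ω·x²` in place of `x²` (pen work, not typed here); ALTERNATIVELY (not typed here): print's LEG currency, (43) p.266 per-leg kernel decay `e^{−κ₁|c−y|/(M₁L^jη)}` × (44) p.267 distance form
`|B_k(c)| < (L^jη)⁻¹|c₋−y|·8L²B₃ g_{k−1}p(g_{k−1})(L^jη)²` (record letters `𝔠.κ₁`, `𝔠.C44` exist), which is polylog-free, hence gives the `₂`-rows a fortiori.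

## 4. BANKED RE-CUT 3⁗₂ (OWNER'S CALL — RULING g22-№3 keeps 3⁗ VERBATIM in v5k; this is the typed, certified form of the STUB 3⁗ docstring's pre-authorised «one registry event,
## consumer-neutral» weakening for the SIZE currency, should the pen confirm that the displayed rows reach sizes only at the shifted profile) — CERTIFIED HERE (§5–§6)

3⁗'s last line `… ∃ π σ C, 7 ≤ σ ∧ 0 ≤ C ∧ GlobalSupRateTSlack (dataOfV3 p π) b₀ p₀ a σ C` ↦ `… ∃ π (p₁ : ℝ) σ C, p₀ ≤ p₁ ∧ 7 ≤ σ ∧ 0 ≤ C ∧ GlobalSupRateTSlack₂ (dataOfV3 p π)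
b₀ p₀ p₁ a σ C` (`GlobalTwoRunSlackFam₂`, §5; WEAKER than registered: `fam₂_of_fam`).  §6 re-proves the v5j‴/v5j⁗ composition with this text (v5k's 3⁗-consumer is the same S-E″ slot; to be
re-checked against the v5k bytes once they exist): `logComparisonRegPrL_of₂` takes the
TYPES of STUB 2′ (`stub_laneRecordsV3`), STUB 3⁗₂ and STUB 4′ (`stub_logComparisonSmallBlocks`) as hypotheses and concludes the skeleton's `logComparisonRegPrL` statement
verbatim (0 sorry) — i.e. the re-cut changes three tokens of `alphaTwoRunOfLaneV3`/`logComparisonRegPrL` and nothing downstream (`FluctuationComparisonRegPrL_of` untouched).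
The pen's chain target becomes the two-letter `K1aLine₂` (rows `CfgSizeΦ₂` §4 etc.: window `p₀`, sizes `p₁`); re-proving `globalTwoRunSlackTail_of_charts` with two
letters is mechanical (the window letter is only ever used through `PlaqSmall`-guards and `(C_s + C_B)θ ≤ 1`-type smallness, which is ASSUMED at `p₁` instead).

WHAT THIS IS NOT: no estimate on Bałaban's data; no claim that 3⁗ (either text) holds; no mass-gap claim; no registry write (the re-cut is the owner's decision).

References: T. Bałaban, CMP 102 (1985) 255–275 [Balaban1985UV3] ((7) p.257, (28) p.263, (34) p.264, p.265 L14–16, (43)–(46) pp.266–267, (57) p.270);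
C. King, CMP 102 (1986) 649–677 [King1986] (Thm 3.4 (3.9) p.656, (3.12)–(3.13) p.657).
-/

noncomputable section

open scoped BigOperators
open MeasureTheory Filter Topology
open Literature.MathematicalPhysics.QuantumFieldTheory.Balaban1983to89
open Literature.MathematicalPhysics.QuantumFieldTheory.Balaban1983to89.T3ContinuumYM3Torus
open Literature.MathematicalPhysics.QuantumFieldTheory.Balaban1983to89.T3LevelShift
open Literature.MathematicalPhysics.QuantumFieldTheory.Balaban1983to89.T3UnitLawDensityEML (ℰp measurableE_ℰp)
open Literature.MathematicalPhysics.QuantumFieldTheory.Balaban1983to89.T3UnitScaleTilt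
open Literature.MathematicalPhysics.QuantumFieldTheory.Balaban1983to89.T3RestrictedUnitDensity
open Literature.MathematicalPhysics.QuantumFieldTheory.Balaban1983to89.T3TiltDescent
open Literature.MathematicalPhysics.QuantumFieldTheory.Balaban1983to89.T3ConstrainedMinimiser
open Literature.MathematicalPhysics.QuantumFieldTheory.Balaban1983to89.T3RegularMinimiser
open Literature.MathematicalPhysics.QuantumFieldTheory.Balaban1983to89.T3PrintedRegularMinimiser
open Literature.MathematicalPhysics.QuantumFieldTheory.Balaban1983to89.T3SmallLiftHistory
open Literature.MathematicalPhysics.QuantumFieldTheory.Balaban1983to89.T3LogComparisonSocket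
open Literature.MathematicalPhysics.QuantumFieldTheory.Balaban1983to89.T3AlphaInputsAC
open Literature.MathematicalPhysics.QuantumFieldTheory.Balaban1983to89.T3AlphaPolymerSocket
open Literature.MathematicalPhysics.QuantumFieldTheory.Balaban1983to89.T3AlphaInputsACTwoRun
open Literature.MathematicalPhysics.QuantumFieldTheory.Balaban1983to89.T3AlphaInputsACTwoRunLevel
open Literature.MathematicalPhysics.QuantumFieldTheory.Balaban1983to89.Missing
open Literature.MathematicalPhysics.QuantumFieldTheory.Balaban1983to89.T4Continuum
open Summit.QuantumFields.Balaban3D.Carriers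
open Summit.QuantumFields.Balaban3D.Proofs.Primitives
open Summit.QuantumFields.YangMills.Theorems
open Summit.QuantumFields.YangMills.Theorems.GlobalSlack (GlobalSupRateTSlack)
open Summit.QuantumFields.YangMills.Theorems.GlobalSlackKernelMatching

namespace Summit.QuantumFields.YangMills.Cruxes.FluctuationComparisonRegPr.Ideate1TwoProfile

/-! ## §1 Profile algebra: the collar polylogarithm is a profile shift -/

section Coupling

variable {L : ℕ} {γ r₀ : ℝ}

/-- `g_i = √(γ L^{-i})`, the effective coupling at distance `i` from the unit scale (the `g` inside `θBal … i`; = g14's `gCo`, LANDED verbatim as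
`GlobalSlackKernelRescale.gCo` (p536544) — duplicated here only because the farm snapshot does not serve that module yet). [cite: Balaban1985UV3, (5) p.256] -/
def gCo (L : ℕ) (γ : ℝ) (i : ℕ) : ℝ := Real.sqrt (γ * ((L : ℝ)⁻¹) ^ i)

/-- `0 < g_i`. [folklore] -/
theorem gCo_pos (hL : 1 ≤ L) (hγ : 0 < γ) (i : ℕ) : 0 < gCo L γ i := by
  unfold gCo
  have hL' : (0 : ℝ) < L := by exact_mod_cast hL
  exact Real.sqrt_pos.mpr (mul_pos hγ (pow_pos (inv_pos.mpr hL') i))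

/-- `g_i ≤ 1` (`0 < γ ≤ 1`, `L ≥ 1`). [cite: Balaban1985UV3, (5) p.256] -/
theorem gCo_le_one (hL : 1 ≤ L) (hγ : 0 < γ) (hγ1 : γ ≤ 1) (i : ℕ) : gCo L γ i ≤ 1 :=
  T3Thresholds.coupling_le_one hL hγ hγ1 i

/-- `1 ≤ 1 + log g_i⁻¹` — the base of every profile power is at least one. [folklore] -/
theorem one_le_logBase (hL : 1 ≤ L) (hγ : 0 < γ) (hγ1 : γ ≤ 1) (i : ℕ) : 1 ≤ 1 + Real.log (gCo L γ i)⁻¹ := by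
  have := B10.log_inv_nonneg_of_le_one (gCo_pos hL hγ i) (gCo_le_one hL hγ hγ1 i)
  linarith

/-- The COLLAR WEIGHT `r(g_i) = (1 + log g_i⁻¹)^{r₀}` ((7) p.257, (39) p.266; = `GlobalSlackKernelRescale.collarW`, p536544). [cite: Balaban1985UV3, (7) p.257] -/
def collarW (L : ℕ) (γ r₀ : ℝ) (i : ℕ) : ℝ := B10.rFun r₀ (gCo L γ i)

/-- `θ(i) = g_i · p(g_i)` (definitional). [cite: Balaban1985UV3, (7) p.257] -/
theorem θBal_eq_gCo_mul_pFun (b₀ p₀ : ℝ) (i : ℕ) : θBal L γ b₀ p₀ i = gCo L γ i * B10.pFun b₀ p₀ (gCo L γ i) := rfl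

/-- **THE COLLAR POLYLOGARITHM IS A PROFILE SHIFT**: `θBal L γ b₀ (p₀ + r₀) i = r(g_i) · θBal L γ b₀ p₀ i` (`0 < γ ≤ 1`, `L ≥ 1`). [cite: Balaban1985UV3, (7) p.257] -/
theorem θBal_add (hL : 1 ≤ L) (hγ : 0 < γ) (hγ1 : γ ≤ 1) (b₀ p₀ r₀ : ℝ) (i : ℕ) :
    θBal L γ b₀ (p₀ + r₀) i = collarW L γ r₀ i * θBal L γ b₀ p₀ i := by
  have hu : 0 < 1 + Real.log (gCo L γ i)⁻¹ := lt_of_lt_of_le one_pos (one_le_logBase hL hγ hγ1 i)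
  rw [θBal_eq_gCo_mul_pFun, θBal_eq_gCo_mul_pFun]
  unfold collarW B10.pFun B10.rFun
  rw [Real.rpow_add hu]
  ring

/-- **(28)'s right-hand side is a size at the shifted profile**: `r(g)·g·p(g) = g·p′(g)` with `p′ = b₀(1 + log g⁻¹)^{p₀+r₀}` (`0 < g ≤ 1`). [cite: Balaban1985UV3, (28) p.263] -/
theorem rFun_mul_pFun {g : ℝ} (hg : 0 < g) (hg1 : g ≤ 1) (b₀ p₀ r₀ : ℝ) :
    B10.rFun r₀ g * g * B10.pFun b₀ p₀ g = g * B10.pFun b₀ (p₀ + r₀) g := by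
  have hu : 0 < 1 + Real.log g⁻¹ := by
    have := B10.log_inv_nonneg_of_le_one hg hg1
    linarith
  unfold B10.rFun B10.pFun
  rw [Real.rpow_add hu]
  ring

/-- **The far-term currency `g⁷(r p)⁷` of G3D-06/07 is `θ′⁷`** (`0 < g ≤ 1`). [cite: Balaban1985UV3, (57) p.270] -/
theorem far_currency {g : ℝ} (hg : 0 < g) (hg1 : g ≤ 1) (b₀ p₀ r₀ : ℝ) :
    g ^ 7 * (B10.rFun r₀ g * B10.pFun b₀ p₀ g) ^ 7 = (g * B10.pFun b₀ (p₀ + r₀) g) ^ 7 := by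
  rw [← mul_pow]
  congr 1
  have := rFun_mul_pFun hg hg1 b₀ p₀ r₀
  linear_combination this

/-- `θBal` is monotone in the profile exponent (`b₀ ≥ 0`, `p₀ ≤ p₁`). [cite: Balaban1985UV3, (7) p.257] -/
theorem θBal_mono_p (hL : 1 ≤ L) (hγ : 0 < γ) (hγ1 : γ ≤ 1) {b₀ p₀ p₁ : ℝ} (hb : 0 ≤ b₀) (hp : p₀ ≤ p₁) (i : ℕ) :
    θBal L γ b₀ p₀ i ≤ θBal L γ b₀ p₁ i := by
  have hg := gCo_pos hL hγ i
  have hu := one_le_logBase hL hγ hγ1 i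
  rw [θBal_eq_gCo_mul_pFun, θBal_eq_gCo_mul_pFun]
  unfold B10.pFun
  exact mul_le_mul_of_nonneg_left (mul_le_mul_of_nonneg_left (Real.rpow_le_rpow_of_exponent_le hu hp) hb) hg.le

/-- The birth couplings along the hierarchy: `log g_{n+m}⁻¹ = log g_n⁻¹ + ½ log Lᵐ` (g14, copied). [cite: Balaban1985UV3, (3) p.256] -/
theorem log_inv_gCo_add (hL : 1 ≤ L) (hγ : 0 < γ) (n m : ℕ) :
    Real.log (gCo L γ (n + m))⁻¹ = Real.log (gCo L γ n)⁻¹ + Real.log (((L : ℝ) ^ m)⁻¹)⁻¹ / 2 := by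
  have hL0 : (0 : ℝ) < L := by exact_mod_cast (show 0 < L by omega)
  have hA : 0 < γ * ((L : ℝ)⁻¹) ^ n := mul_pos hγ (pow_pos (inv_pos.mpr hL0) n)
  have hx : 0 < ((L : ℝ)⁻¹) ^ m := pow_pos (inv_pos.mpr hL0) m
  unfold gCo
  rw [pow_add, ← mul_assoc, Real.sqrt_mul hA.le, inv_inv]
  simp only [Real.log_inv]
  rw [Real.log_mul (Real.sqrt_pos.mpr hA).ne' (Real.sqrt_pos.mpr hx).ne', Real.log_sqrt hx.le]
  simp only [inv_pow, Real.log_inv]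
  ring

/-- **SPLITTING OF THE COLLAR WEIGHT ALONG THE HIERARCHY** (g14, copied): `r_{n+m} ≤ r_n · (1 + log Lᵐ)^{r₀}`. [cite: Balaban1985UV3, (7) p.257] -/
theorem collarW_add_le (hL : 1 ≤ L) (hγ : 0 < γ) (hγ1 : γ ≤ 1) (hr : 0 ≤ r₀) (n m : ℕ) :
    collarW L γ r₀ (n + m) ≤ collarW L γ r₀ n * (1 + Real.log (((L : ℝ) ^ m)⁻¹)⁻¹) ^ r₀ := by
  have ha := B10.log_inv_nonneg_of_le_one (gCo_pos hL hγ n) (gCo_le_one hL hγ hγ1 n)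
  have hL1 : (1 : ℝ) ≤ L := by exact_mod_cast hL
  have hx0 : 0 < ((L : ℝ) ^ m)⁻¹ := by positivity
  have hx1 : ((L : ℝ) ^ m)⁻¹ ≤ 1 := inv_le_one_of_one_le₀ (one_le_pow₀ hL1)
  have hu := B10.log_inv_nonneg_of_le_one hx0 hx1
  unfold collarW B10.rFun
  rw [log_inv_gCo_add hL hγ n m, ← Real.mul_rpow (by linarith) (by linarith)]
  exact Real.rpow_le_rpow (by linarith) (by nlinarith [mul_nonneg ha hu]) hr

/-- **ONE LEVEL COSTS A FACTOR `(1 + log L)^{r₀}`**: `r_{n+1} ≤ (1 + log L)^{r₀} · r_n` — the birth co-height `n+1` versus the comparison co-height `n`. [cite: Balaban1985UV3, (7) p.257] -/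
theorem collarW_succ_le (hL : 1 ≤ L) (hγ : 0 < γ) (hγ1 : γ ≤ 1) (hr : 0 ≤ r₀) (n : ℕ) :
    collarW L γ r₀ (n + 1) ≤ (1 + Real.log (L : ℝ)) ^ r₀ * collarW L γ r₀ n := by
  have h := collarW_add_le hL hγ hγ1 hr n 1
  rw [pow_one, inv_inv] at h
  linarith [mul_comm (collarW L γ r₀ n) ((1 + Real.log (L : ℝ)) ^ r₀)]

/-- **THE SHIFTED PROFILE ACROSS ONE LEVEL**: `θ′(n+1) ≤ (1 + log L)^{r₀}·r_n·θ(n+1)` — with `θ(n+1) ≤ θ(n)` on the monotone window this is `≤ (1 + log L)^{r₀}·θ′(n)`.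
[cite: Balaban1985UV3, (7) p.257] -/
theorem θBal_add_succ_le (hL : 1 ≤ L) (hγ : 0 < γ) (hγ1 : γ ≤ 1) {b₀ : ℝ} (hb : 0 < b₀) (hr : 0 ≤ r₀) (p₀ : ℝ) (n : ℕ) :
    θBal L γ b₀ (p₀ + r₀) (n + 1) ≤ (1 + Real.log (L : ℝ)) ^ r₀ * collarW L γ r₀ n * θBal L γ b₀ p₀ (n + 1) := by
  rw [θBal_add hL hγ hγ1]
  exact mul_le_mul_of_nonneg_right (collarW_succ_le hL hγ hγ1 hr n) (T3MinimiserStabilityReduction.θBal_pos hL hγ hγ1 hb p₀ (n + 1)).le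

end Coupling

/-! ## §2 The two-profile slack row: WINDOW at `p₀`, SIZES at `p₁` -/

section TwoProfile

variable {F : T3Family} {γ : ℝ} (D : AlphaDataT3 F γ)

/-- **THE GLOBAL TWO-RUN ROW WITH KING'S ADDITIVE SLACK, TWO PROFILES** (hypothesis schema, never asserted; F-idea1-g15-1): on the `θ(n) = θBal b₀ p₀ n`-window,
`|PintH (K+1) n V − PintH K n V − c K n| ≤ C·#Site(F.P n)·(θ′(n)²·L^{−a(K−n)} + θ′(n)^σ)` with `θ′(n) = θBal b₀ p₁ n` — the landed `GlobalSupRateTSlack` with the two SIZE factors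
read at the shifted profile `p₁` (intended `p₁ = p₀ + r₀`, print's collar polylogarithm `r(g) = (1 + log g⁻¹)^{r₀}` of (28) absorbed by `θBal_add`). [cite: King1986, Thm 3.4 (3.9) p.656; Balaban1985UV3, (28) p.263] -/
def GlobalSupRateTSlack₂ (b₀ p₀ p₁ a : ℝ) (σ : ℕ) (C : ℝ) : Prop :=
  ∃ c : ℕ → ℕ → ℝ, ∀ (K n : ℕ), n ≤ K → ∀ V : GaugeField (F.P n) 0 (Matrix.specialUnitaryGroup (Fin 2) ℂ), PlaqSmall (θBal F.L γ b₀ p₀ n) V →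
    |D.PintH (K + 1) n V - D.PintH K n V - c K n| ≤
      C * (Fintype.card (Site (F.P n) 0) : ℝ) * (θBal F.L γ b₀ p₁ n ^ 2 * (((F.L : ℝ) ^ (K - n))⁻¹) ^ a + θBal F.L γ b₀ p₁ n ^ σ)

/-- `p₁ = p₀` IS the landed row (definitionally). [cite: King1986, Thm 3.4 (3.9) p.656] -/
theorem slack₂_self_iff {b₀ p₀ a C : ℝ} {σ : ℕ} : GlobalSupRateTSlack₂ D b₀ p₀ p₀ a σ C ↔ GlobalSupRateTSlack D b₀ p₀ a σ C := Iff.rfl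

/-- **NOTHING PROVED FOR 3⁗ AS REGISTERED IS LOST**: the landed row implies the two-profile row for every `p₁ ≥ p₀`, same constant (`0 < γ ≤ 1`, `0 < b₀`, `0 ≤ C`).
[cite: King1986, Thm 3.4 (3.9) p.656] -/
theorem slack₂_of_slack {b₀ p₀ p₁ a C : ℝ} {σ : ℕ} (hγ : 0 < γ) (hγ1 : γ ≤ 1) (hb : 0 < b₀) (hp : p₀ ≤ p₁) (hC : 0 ≤ C)
    (h : GlobalSupRateTSlack D b₀ p₀ a σ C) : GlobalSupRateTSlack₂ D b₀ p₀ p₁ a σ C := by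
  obtain ⟨c, hc⟩ := h
  refine ⟨c, fun K n hn V hV => (hc K n hn V hV).trans ?_⟩
  have hL : 1 ≤ F.L := F.hL.2.le
  have hθ0 : 0 ≤ θBal F.L γ b₀ p₀ n := (T3MinimiserStabilityReduction.θBal_pos hL hγ hγ1 hb p₀ n).le
  have hθ := θBal_mono_p hL hγ hγ1 hb.le hp n
  have hx : 0 ≤ (((F.L : ℝ) ^ (K - n))⁻¹) ^ a := Real.rpow_nonneg (inv_nonneg.mpr (pow_nonneg (Nat.cast_nonneg _) _)) a
  have h2 : θBal F.L γ b₀ p₀ n ^ 2 ≤ θBal F.L γ b₀ p₁ n ^ 2 := pow_le_pow_left₀ hθ0 hθ 2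
  have hs : θBal F.L γ b₀ p₀ n ^ σ ≤ θBal F.L γ b₀ p₁ n ^ σ := pow_le_pow_left₀ hθ0 hθ σ
  exact mul_le_mul_of_nonneg_left (add_le_add (mul_le_mul_of_nonneg_right h2 hx) hs) (mul_nonneg hC (Nat.cast_nonneg _))

/-- The landed row AT THE WIDER PROFILE `p₁ ≥ p₀` (window and sizes at `p₁`) also implies the two-profile row (window inclusion). [cite: King1986, Thm 3.4 (3.9) p.656] -/
theorem slack₂_of_slack_wide {b₀ p₀ p₁ a C : ℝ} {σ : ℕ} (hγ : 0 < γ) (hγ1 : γ ≤ 1) (hb : 0 ≤ b₀) (hp : p₀ ≤ p₁)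
    (h : GlobalSupRateTSlack D b₀ p₁ a σ C) : GlobalSupRateTSlack₂ D b₀ p₀ p₁ a σ C := by
  obtain ⟨c, hc⟩ := h
  refine ⟨c, fun K n hn V hV => hc K n hn V ?_⟩
  have hθ := θBal_mono_p F.hL.2.le hγ hγ1 hb hp n
  exact fun q => (hV q).trans_le hθ

/-- Monotonicity of the two-profile row in the size profile. [folklore] -/
theorem slack₂_mono {b₀ p₀ p₁ p₂ a C : ℝ} {σ : ℕ} (hγ : 0 < γ) (hγ1 : γ ≤ 1) (hb : 0 < b₀) (hp : p₁ ≤ p₂) (hC : 0 ≤ C)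
    (h : GlobalSupRateTSlack₂ D b₀ p₀ p₁ a σ C) : GlobalSupRateTSlack₂ D b₀ p₀ p₂ a σ C := by
  obtain ⟨c, hc⟩ := h
  refine ⟨c, fun K n hn V hV => (hc K n hn V hV).trans ?_⟩
  have hL : 1 ≤ F.L := F.hL.2.le
  have hθ0 : 0 ≤ θBal F.L γ b₀ p₁ n := (T3MinimiserStabilityReduction.θBal_pos hL hγ hγ1 hb p₁ n).le
  have hθ := θBal_mono_p hL hγ hγ1 hb.le hp n
  have hx : 0 ≤ (((F.L : ℝ) ^ (K - n))⁻¹) ^ a := Real.rpow_nonneg (inv_nonneg.mpr (pow_nonneg (Nat.cast_nonneg _) _)) a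
  exact mul_le_mul_of_nonneg_left (add_le_add (mul_le_mul_of_nonneg_right (pow_le_pow_left₀ hθ0 hθ 2) hx) (pow_le_pow_left₀ hθ0 hθ σ))
    (mul_nonneg hC (Nat.cast_nonneg _))

/-! ## §3 The consumer BY NAME: summability only ever used the SIZE profile -/

/-- **THE DIRECT CONSUMER OF THE TWO-PROFILE ROW** (pure counting, = the port's proof with `summable_slackRadii` at `p₁`): for `1 < L`, `0 < γ ≤ 1`, `0 < b₀`, `0 < p₁`,
`0 < a`, `0 ≤ C`, `m > (3+a)/a`, a geometric profile `θ′(n) ≤ C_θρⁿ` (`ρ ≥ 0`) with `ρ^σL³ < 1`: `GlobalSupRateTSlack₂ D b₀ p₀ p₁ a σ C ⟹ CauchyAtHeights D b₀ p₀ m`.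
[cite: King1986, Thm 3.4 (3.9) p.656 and (3.12)-(3.13) p.657] -/
theorem cauchyAtHeights_of_globalSupRateTSlack₂ {b₀ p₀ p₁ a C Cθ ρ : ℝ} {σ m : ℕ}
    (hL : 1 < F.L) (hγ : 0 < γ) (hγ1 : γ ≤ 1) (hb : 0 < b₀) (hp₁ : 0 < p₁) (ha : 0 < a) (hC : 0 ≤ C)
    (hm : (3 + a) / a < (m : ℝ)) (hρ : 0 ≤ ρ) (hθρ : ∀ n, θBal F.L γ b₀ p₁ n ≤ Cθ * ρ ^ n) (hρσ : ρ ^ σ * (F.L : ℝ) ^ 3 < 1)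
    (h : GlobalSupRateTSlack₂ D b₀ p₀ p₁ a σ C) : CauchyAtHeights D b₀ p₀ m := by
  obtain ⟨c, hc⟩ := h
  exact GlobalSlack.cauchyAtHeights_of_windowBound D _ (fun K => c K (K / m))
    (GlobalSlackOn.summable_slackRadii hL hγ hγ1 hb hp₁ ha hC hm hρ hθρ hρσ) (GlobalSlackOn.slackRadii_nonneg hL.le hγ hγ1 hb hC)
    (fun K V hV => hc K (K / m) (Nat.div_le_self K m) V hV)

/-- **THE DIRECT CONSUMER, SHARP PROFILE, `σ ≥ 7`** (`c = 1/8`: `ρ = L^{−7/16}`, `ρ⁷L³ = L^{−1/16} < 1`; NO hypothesis relating `p₀` and `p₁`).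
[cite: Balaban1985UV3, (57) p.270; King1986, Thm 3.4 (3.9) p.656] -/
theorem cauchyAtHeights_of_globalSupRateTSlack₂_seven {b₀ p₀ p₁ a C : ℝ} {σ m : ℕ}
    (hL : 1 < F.L) (hγ : 0 < γ) (hγ1 : γ ≤ 1) (hb : 0 < b₀) (hp₁ : 0 < p₁) (ha : 0 < a) (hC : 0 ≤ C)
    (hm : (3 + a) / a < (m : ℝ)) (hσ : 7 ≤ σ) (h : GlobalSupRateTSlack₂ D b₀ p₀ p₁ a σ C) : CauchyAtHeights D b₀ p₀ m := by
  have hc : (0 : ℝ) < 1 / 8 := by norm_num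
  have hσr : (7 : ℝ) ≤ σ := by exact_mod_cast hσ
  refine cauchyAtHeights_of_globalSupRateTSlack₂ D hL hγ hγ1 hb hp₁ ha hC hm (ρ := ((F.L : ℝ)⁻¹) ^ ((1 - 1 / 8 : ℝ) / 2))
    (Cθ := b₀ * ((p₁ / (1 / 8)) ^ p₁ * Real.exp (1 / 8 - p₁)) * γ ^ ((1 - 1 / 8 : ℝ) / 2))
    (by positivity) (fun n => GlobalSlack.θBal_le_geometric_sharp hL.le hγ hγ1 hb.le hp₁ hc n) ?_ h
  exact GlobalSlack.slack_ratio_lt_one hL (by nlinarith)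

end TwoProfile

/-- **THE S-E″ SLOT OVER THE TWO-PROFILE ROW, REGISTERED QUANTIFIER SHAPE** (`ε₁ = γ₁ = 1`, `m₀ = ⌈(3+a)/a⌉ + 1` — UNCHANGED; `p₁ ≥ p₀`, `σ ≥ 7` and `C ≥ 0` may depend on the
family): `GlobalSupRateTSlack₂ D b₀ p₀ p₁ a σ C → CauchyAtHeights D b₀ p₀ m`.  Drop-in for `landed_levelCauchyOfGlobalSupRateTSlack` of v5j‴/v5j⁗. [cite: King1986, Thm 3.4 (3.9) p.656] -/
theorem levelCauchyOfGlobalSupRateTSlack₂_dec :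
    ∀ (L : ℕ), Odd L → 1 < L → ∀ (a : ℝ), 0 < a →
      ∃ ε₁ : ℝ, 0 < ε₁ ∧ ∀ (ε₀ : ℝ), 0 < ε₀ → ε₀ ≤ ε₁ → ∃ m₀ : ℕ, ∀ (m : ℕ), m₀ ≤ m → ∀ (b₀ p₀ : ℝ), 0 < b₀ → 2 < p₀ →
        ∃ γ₁ : ℝ, 0 < γ₁ ∧ ∀ (F : T3Family) (γ : ℝ), F.L = L → 0 < γ → γ ≤ γ₁ →
          ∀ (D : AlphaDataT3 F γ) (p₁ : ℝ) (σ : ℕ) (C : ℝ), p₀ ≤ p₁ → 7 ≤ σ → 0 ≤ C →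
            GlobalSupRateTSlack₂ D b₀ p₀ p₁ a σ C → CauchyAtHeights D b₀ p₀ m := by
  intro L _ hL a ha
  refine ⟨1, one_pos, fun ε₀ _ _ => ⟨Nat.ceil ((3 + a) / a) + 1, fun m hm b₀ p₀ hb hp => ?_⟩⟩
  refine ⟨1, one_pos, fun F γ hF hγ hγ1 D p₁ σ C hp₁ hσ hC h => ?_⟩
  have hL' : 1 < F.L := by rw [hF]; exact hL
  exact cauchyAtHeights_of_globalSupRateTSlack₂_seven D hL' hγ hγ1 hb (by linarith) ha hC (GlobalSlack.lt_of_ceil_succ_le hm) hσ h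

/-! ## §4 Two-profile record rows (the pen's two-letter chain target, schemas only) and the birth-row dictionary -/

section Rows

variable {𝕍 : Type} [NormedAddCommGroup 𝕍] {F : T3Family} {γ : ℝ}

/-- **CONFIGURATION SIZE ROW, TWO PROFILES** = the record's `CfgSizeΦ` (p529311 §2) with the WINDOW at `p₀` and the SIZE factor `θBal b₀ p₁ n`: at `p₁ = p₀ + r₀` and the
birth level this is (28) p.263 VERBATIM (`rFun_mul_pFun`), polylogarithm included. [cite: Balaban1985UV3, (28) p.263, (44) p.267] -/
def CfgSizeΦ₂ (D : AlphaDataT3 F γ) (B : CfgFam 𝕍 F) (b₀ p₀ p₁ C_s : ℝ) : Prop :=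
  ∀ (K n : ℕ) (h : n ≤ K), ∀ j : ℕ, j < K - n →
    ∀ V : GaugeField (F.P n) 0 (Matrix.specialUnitaryGroup (Fin 2) ℂ), PlaqSmall (θBal F.L γ b₀ p₀ n) V →
      ∀ Y ∈ D.Loc K (K - n) (D.triv K (K - n)) (1 + j),
        ‖B K (K - n) j Y
            (fieldShift (F.sitesPerDir_eq (m := F.m) (K := K) (j := K - n) (m' := F.m) (K' := n) (j' := 0) (by omega)) V)‖ ≤
          C_s * θBal F.L γ b₀ p₁ n * (((F.L : ℝ) ^ (K - n - 1 - j))⁻¹) ^ 2 ∧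
        ‖(fun c => B (K + 1) (K + 1 - n) (j + 1) (refineSet F K Y)
            (fieldShift (F.sitesPerDir_eq (m := F.m) (K := K + 1) (j := K + 1 - n) (m' := F.m) (K' := n) (j' := 0) (by omega)) V)
            (matchBond F K j c))‖ ≤
          C_s * θBal F.L γ b₀ p₁ n * (((F.L : ℝ) ^ (K - n - 1 - j))⁻¹) ^ 2

/-- `p₁ = p₀` IS the record row (definitionally). [cite: Balaban1985UV3, (28) p.263] -/
theorem cfgSizeΦ₂_self_iff (D : AlphaDataT3 F γ) (B : CfgFam 𝕍 F) (b₀ p₀ C_s : ℝ) :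
    CfgSizeΦ₂ D B b₀ p₀ p₀ C_s ↔ CfgSizeΦ D B b₀ p₀ C_s := Iff.rfl

/-- A polylog-free record row (e.g. one displayed in print's LEG currency (43)×(44)) gives the two-profile row a fortiori (`0 ≤ C_s`, `p₀ ≤ p₁`). [cite: Balaban1985UV3, (43)-(44) pp.266-267] -/
theorem cfgSizeΦ₂_of_cfgSizeΦ (D : AlphaDataT3 F γ) (B : CfgFam 𝕍 F) {b₀ p₀ p₁ C_s : ℝ} (hγ : 0 < γ) (hγ1 : γ ≤ 1) (hb : 0 ≤ b₀) (hp : p₀ ≤ p₁)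
    (hCs : 0 ≤ C_s) (h : CfgSizeΦ D B b₀ p₀ C_s) : CfgSizeΦ₂ D B b₀ p₀ p₁ C_s := by
  intro K n hn j hj V hV Y hY
  obtain ⟨h1, h2⟩ := h K n hn j hj V hV Y hY
  have hθ := θBal_mono_p F.hL.2.le hγ hγ1 hb hp n
  have hx : 0 ≤ (((F.L : ℝ) ^ (K - n - 1 - j))⁻¹) ^ (2 : ℕ) := pow_nonneg (inv_nonneg.mpr (pow_nonneg (Nat.cast_nonneg _) _)) 2
  have hmono : C_s * θBal F.L γ b₀ p₀ n * (((F.L : ℝ) ^ (K - n - 1 - j))⁻¹) ^ 2 ≤ C_s * θBal F.L γ b₀ p₁ n * (((F.L : ℝ) ^ (K - n - 1 - j))⁻¹) ^ 2 :=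
    mul_le_mul_of_nonneg_right (mul_le_mul_of_nonneg_left hθ hCs) hx
  exact ⟨h1.trans hmono, h2.trans hmono⟩

/-- **BIRTH-ROW DICTIONARY, (28)**: a bound `‖B‖ ≤ cB·(r(g_i)·g_i·p(g_i))·x²` IS the two-profile size `cB·θBal b₀ (p₀+r₀) i·x²`. [cite: Balaban1985UV3, (28) p.263] -/
theorem bound28_currency {L : ℕ} (hL : 1 ≤ L) (hγ : 0 < γ) (hγ1 : γ ≤ 1) (cB b₀ p₀ r₀ x : ℝ) (i : ℕ) :
    cB * (B10.rFun r₀ (gCo L γ i) * gCo L γ i * B10.pFun b₀ p₀ (gCo L γ i)) * x = cB * θBal L γ b₀ (p₀ + r₀) i * x := by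
  rw [rFun_mul_pFun (gCo_pos hL hγ i) (gCo_le_one hL hγ hγ1 i), ← θBal_eq_gCo_mul_pFun]

/-- **BIRTH-ROW DICTIONARY, far terms**: `Cfar·M·(g_i⁷ (r(g_i) p(g_i))⁷) = Cfar·M·θBal b₀ (p₀+r₀) i ^ 7` — the slack half at the shifted profile with `σ = 7 ∈ ℕ`.
[cite: Balaban1985UV3, (57) p.270] -/
theorem far_currency_θBal {L : ℕ} (hL : 1 ≤ L) (hγ : 0 < γ) (hγ1 : γ ≤ 1) (Cfar M b₀ p₀ r₀ : ℝ) (i : ℕ) :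
    Cfar * M * (gCo L γ i ^ 7 * (B10.rFun r₀ (gCo L γ i) * B10.pFun b₀ p₀ (gCo L γ i)) ^ 7) = Cfar * M * θBal L γ b₀ (p₀ + r₀) i ^ 7 := by
  rw [far_currency (gCo_pos hL hγ i) (gCo_le_one hL hγ hγ1 i), ← θBal_eq_gCo_mul_pFun]

end Rows

/-! ## §5 The re-cut STUB 3⁗ text (banked 3⁗₂) and «nothing lost» -/

/-- The REGISTERED STUB 3⁗ text of v5j‴/v5j⁗ (verbatim, as a Prop). [cite: King1986, Thm 3.4 (3.9) p.656; Balaban1985UV3, (43)-(46) pp.266-267 and (57) p.270] -/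
def GlobalTwoRunSlackFam : Prop :=
  ∀ (L : ℕ), Odd L → 7 ≤ L → ∀ (𝔠 : Summit.QuantumFields.Balaban3D.Proofs.Primitives.AlphaConsts L (Summit.QuantumFields.Balaban3D.Carriers.suGroupModel 2).N)
    (a₀ a₁ : ℝ), 0 < a₀ → 0 < a₁ → 𝔠.B₃ * a₁ ≤ a₀ →
    ∃ a : ℝ, 0 < a ∧ ∃ γB : ℝ, 0 < γB ∧ ∀ (F : T3Family) (γ : ℝ) (hF : F.L = L) (hγ : 0 < γ), γ ≤ γB →
      ∀ (hγ1 : γ ≤ (min (hF ▸ 𝔠).gamma0 1) ^ 2),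
        Summit.QuantumFields.YangMills.Theorems.AlphaInputsT3AC.OfV3At F (hF ▸ 𝔠) a₀ a₁ →
        ∃ (p : ∀ K, Summit.QuantumFields.YangMills.Theorems.AlphaInputsT3AC.PkgAtV3 F (hF ▸ 𝔠) γ hγ hγ1 K),
          (∀ K, (p K).a₀ = a₀ ∧ (p K).a₁ = a₁) ∧
          ∃ (π : Summit.QuantumFields.YangMills.Theorems.AlphaInputsT3AC.PolymerT3 F) (σ : ℕ) (C : ℝ), 7 ≤ σ ∧ 0 ≤ C ∧
            Summit.QuantumFields.YangMills.Theorems.GlobalSlack.GlobalSupRateTSlack (Summit.QuantumFields.YangMills.Theorems.AlphaInputsT3AC.dataOfV3 p π) (hF ▸ 𝔠).b₀ (hF ▸ 𝔠).p₀ a σ C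

/-- **STUB 3⁗₂ — THE BANKED RE-CUT TEXT** (F-idea1-g15-1; owner's call, not before the pen confirms the need): 3⁗ with its last line read at TWO PROFILES — window `(hF ▸ 𝔠).p₀`, sizes at SOME `p₁ ≥ (hF ▸ 𝔠).p₀`
(intended `p₁ = p₀ + r₀`: print's collar polylogarithm (28) p.263 as a profile shift, `θBal_add`), bound per family next to `σ, C`. [cite: King1986, Thm 3.4 (3.9) p.656; Balaban1985UV3, (28) p.263, (43)-(46) pp.266-267 and (57) p.270] -/
def GlobalTwoRunSlackFam₂ : Prop :=
  ∀ (L : ℕ), Odd L → 7 ≤ L → ∀ (𝔠 : Summit.QuantumFields.Balaban3D.Proofs.Primitives.AlphaConsts L (Summit.QuantumFields.Balaban3D.Carriers.suGroupModel 2).N)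
    (a₀ a₁ : ℝ), 0 < a₀ → 0 < a₁ → 𝔠.B₃ * a₁ ≤ a₀ →
    ∃ a : ℝ, 0 < a ∧ ∃ γB : ℝ, 0 < γB ∧ ∀ (F : T3Family) (γ : ℝ) (hF : F.L = L) (hγ : 0 < γ), γ ≤ γB →
      ∀ (hγ1 : γ ≤ (min (hF ▸ 𝔠).gamma0 1) ^ 2),
        Summit.QuantumFields.YangMills.Theorems.AlphaInputsT3AC.OfV3At F (hF ▸ 𝔠) a₀ a₁ →
        ∃ (p : ∀ K, Summit.QuantumFields.YangMills.Theorems.AlphaInputsT3AC.PkgAtV3 F (hF ▸ 𝔠) γ hγ hγ1 K),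
          (∀ K, (p K).a₀ = a₀ ∧ (p K).a₁ = a₁) ∧
          ∃ (π : Summit.QuantumFields.YangMills.Theorems.AlphaInputsT3AC.PolymerT3 F) (p₁ : ℝ) (σ : ℕ) (C : ℝ), (hF ▸ 𝔠).p₀ ≤ p₁ ∧ 7 ≤ σ ∧ 0 ≤ C ∧
            GlobalSupRateTSlack₂ (Summit.QuantumFields.YangMills.Theorems.AlphaInputsT3AC.dataOfV3 p π) (hF ▸ 𝔠).b₀ (hF ▸ 𝔠).p₀ p₁ a σ C

/-- **NOTHING LOST**: the registered 3⁗ text implies the proposed 3⁗₂ text (`p₁ := p₀`, `slack₂_self_iff`). [cite: King1986, Thm 3.4 (3.9) p.656] -/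
theorem fam₂_of_fam (h : GlobalTwoRunSlackFam) : GlobalTwoRunSlackFam₂ := by
  intro L hLo h7 𝔠 a₀ a₁ ha0 ha1 hw
  obtain ⟨a, ha, γB, hγB, hBC⟩ := h L hLo h7 𝔠 a₀ a₁ ha0 ha1 hw
  refine ⟨a, ha, γB, hγB, fun F γ hF hγ hγB' => ?_⟩
  subst hF
  intro hγ1 hOf
  obtain ⟨p, hp, π, σ, C, hσ, hC0, hG⟩ := hBC F γ rfl hγ hγB' hγ1 hOf
  exact ⟨p, hp, π, _, σ, C, le_rfl, hσ, hC0, hG⟩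

/-! ## §6 THE COMPOSITION WITH 3⁗₂, CERTIFIED: STUB 2′ ∧ STUB 3⁗₂ ∧ STUB 4′ ⟹ `logComparisonRegPrL` (verbatim), 0 sorry -/

/-- The common body of `logComparisonRegPrL` / STUB 4′ (the two-run log comparison with summable radii, v3′ threshold order), as a Prop of the block size. [cite: King1986, Thm 3.4 (3.9) p.656] -/
abbrev LogCompBody (L : ℕ) : Prop :=
  ∃ (b₁ p₁ : ℝ), ∀ (b₀ p₀ : ℝ), b₁ ≤ b₀ → p₁ ≤ p₀ → 0 < b₀ → 2 < p₀ →
    ∃ ε₁ : ℝ, 0 < ε₁ ∧ ∀ (ε₀ : ℝ), 0 < ε₀ → ε₀ ≤ ε₁ → ∃ m₀ : ℕ, ∀ (m : ℕ), m₀ ≤ m →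
      ∃ γ₁ : ℝ, 0 < γ₁ ∧ ∀ (F : T3Family) (γ : ℝ), F.L = L → 0 < γ → γ ≤ γ₁ →
        ∃ (r κ : ℕ → ℝ), Summable r ∧ (∀ K, 0 ≤ r K) ∧
          ∀ K, ∀ᵐ V ∂fieldMeasure (F.P (K / m)) 0 (Matrix.specialUnitaryGroup (Fin 2) ℂ),
            PlaqSmall (θBal F.L γ b₀ p₀ (K / m)) V →
              0 < heightDensity F γ (Nat.div_le_self K m) (histGood F ℰp (θBal F.L γ b₀ p₀) K (K / m)) V →
              0 < heightDensity F γ ((Nat.div_le_self K m).trans (Nat.le_succ K))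
                    (histGood F ℰp (θBal F.L γ b₀ p₀) (K + 1) (K / m)) V →
                |(Real.log (heightDensity F γ ((Nat.div_le_self K m).trans (Nat.le_succ K))
                      (histGood F ℰp (θBal F.L γ b₀ p₀) (K + 1) (K / m)) V) + bgRegPr' F γ m ε₀ K V) -
                  (Real.log (heightDensity F γ (Nat.div_le_self K m) (histGood F ℰp (θBal F.L γ b₀ p₀) K (K / m)) V) + bgRegPr F γ m ε₀ K V) -
                    κ K| ≤ r K

/-- **THE α-ADAPTER OVER THE TWO-PROFILE ROW** (v5j‴'s `alphaTwoRunOfLaneV3` with 3⁗₂ in place of 3⁗ — two tokens change: `∃ p₁ σ C, p₀ ≤ p₁ ∧ …`): conjunct (A) by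
`AlphaInputsT3AC.repAtHeights_dataOfV3`, thresholds by `LogComparisonAlphaAdapter.exists_gamma_thresholds`. [cite: Balaban1985UV3, Thm 2 p.272; King1986, Prop. 3.8-3.9 pp.664-665] -/
theorem alphaTwoRunOfLaneV3₂ (h3 : GlobalTwoRunSlackFam₂) :
    ∀ (L : ℕ), Odd L → 7 ≤ L → ∀ (𝔠 : Summit.QuantumFields.Balaban3D.Proofs.Primitives.AlphaConsts L (Summit.QuantumFields.Balaban3D.Carriers.suGroupModel 2).N)
      (a₀ a₁ : ℝ), 0 < a₀ → 0 < a₁ → 𝔠.B₃ * a₁ ≤ a₀ →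
      ∃ ε₁ : ℝ, 0 < ε₁ ∧ ∃ a : ℝ, 0 < a ∧ ∀ (ε₀ : ℝ), 0 < ε₀ → ε₀ ≤ ε₁ →
        ∃ γ₁ : ℝ, 0 < γ₁ ∧ ∀ (F : T3Family) (γ : ℝ) (hF : F.L = L), 0 < γ → γ ≤ γ₁ →
          Summit.QuantumFields.YangMills.Theorems.AlphaInputsT3AC.OfV3At F (hF ▸ 𝔠) a₀ a₁ →
            ∃ (D : AlphaDataT3 F γ), RepAtHeights D 𝔠.b₀ 𝔠.p₀ ε₀ ∧
              ∃ (p₁ : ℝ) (σ : ℕ) (C : ℝ), 𝔠.p₀ ≤ p₁ ∧ 7 ≤ σ ∧ 0 ≤ C ∧ GlobalSupRateTSlack₂ D 𝔠.b₀ 𝔠.p₀ p₁ a σ C := by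
  intro L hLo h7 𝔠 a₀ a₁ ha0 ha1 hw
  obtain ⟨a, ha, γB, hγB, hBC⟩ := h3 L hLo h7 𝔠 a₀ a₁ ha0 ha1 hw
  refine ⟨a₀, ha0, a, ha, fun ε₀ hε hhi => ?_⟩
  obtain ⟨γT, hγT, -, hT⟩ := Summit.QuantumFields.YangMills.Theorems.LogComparisonAlphaAdapter.exists_gamma_thresholds
    (B₃ := 𝔠.B₃) 𝔠.b₀_pos 𝔠.p₀_pos ha1 𝔠.B₃_pos.le hε
  have hg0 : 0 < (min 𝔠.gamma0 1) ^ 2 := pow_pos (lt_min 𝔠.gamma0_pos one_pos) 2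
  refine ⟨min γB (min γT ((min 𝔠.gamma0 1) ^ 2)), lt_min hγB (lt_min hγT hg0), fun F γ hF hγ hγ₁ hOf => ?_⟩
  subst hF
  have hγB' : γ ≤ γB := hγ₁.trans (min_le_left _ _)
  have hγT' : γ ≤ γT := hγ₁.trans ((min_le_right _ _).trans (min_le_left _ _))
  have hγ1 : γ ≤ (min 𝔠.gamma0 1) ^ 2 := hγ₁.trans ((min_le_right _ _).trans (min_le_right _ _))
  obtain ⟨p, hp, π, p₁, σ, C, hp₁, hσ, hC0, hG⟩ := hBC F γ rfl hγ hγB' hγ1 hOf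
  obtain ⟨hT1, hT2, hT3⟩ := hT F.L F.hL.2.le γ hγ hγT'
  exact ⟨Summit.QuantumFields.YangMills.Theorems.AlphaInputsT3AC.dataOfV3 p π,
    Summit.QuantumFields.YangMills.Theorems.AlphaInputsT3AC.repAtHeights_dataOfV3 p π hp ε₀ hε hhi hT1 hT2 hT3, p₁, σ, C, hp₁, hσ, hC0, hG⟩

/-- **THE COMPOSITION WITH 3⁗₂** — `logComparisonRegPrL` (v5j‴ statement, verbatim) from the TYPES of STUB 2′, STUB 3⁗₂ and STUB 4′: the v5j‴ proof with the landed S-E″ slot replaced by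
`levelCauchyOfGlobalSupRateTSlack₂_dec` and the one line `hS' F γ hF hγ hγs' D σ C hσ hC0 hG ↦ hS' F γ hF hγ hγs' D p₁ σ C hp₁ hσ hC0 hG`.  [cite: King1986, Thm 3.4 (3.9) p.656] -/
theorem logComparisonRegPrL_of₂
    (h2 : ∀ L : ℕ, Odd L → 1 < L → Summit.QuantumFields.YangMills.Theorems.AlphaInputsT3ACv3Rec L)
    (h3 : GlobalTwoRunSlackFam₂)
    (h4 : ∀ (L : ℕ), Odd L → 1 < L → L < 7 → LogCompBody L) :
    ∀ (L : ℕ), Odd L → 1 < L → LogCompBody L := by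
  intro L hLo hL
  by_cases h7 : 7 ≤ L
  swap
  · exact h4 L hLo hL (not_le.mp h7)
  obtain ⟨b₁, p₁, hrec⟩ := h2 L hLo hL
  refine ⟨b₁, p₁, fun b₀ p₀ hb1 hp1 hb hp => ?_⟩
  obtain ⟨𝔠, a₀, a₁, hcb, hcp, ha0, ha1, hw, h𝔠⟩ := hrec b₀ p₀ hb1 hp1
  subst hcb
  subst hcp
  obtain ⟨εa, hεa, a, ha, hA⟩ := alphaTwoRunOfLaneV3₂ h3 L hLo h7 𝔠 a₀ a₁ ha0 ha1 hw
  obtain ⟨εs, hεs, hS⟩ := levelCauchyOfGlobalSupRateTSlack₂_dec L hLo hL a ha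
  refine ⟨min εa εs, lt_min hεa hεs, fun ε₀ h0 h1 => ?_⟩
  have h1a : ε₀ ≤ εa := h1.trans (min_le_left _ _)
  have h1s : ε₀ ≤ εs := h1.trans (min_le_right _ _)
  obtain ⟨m₀, hm₀⟩ := hS ε₀ h0 h1s
  refine ⟨max m₀ 1, fun m hm => ?_⟩
  have hmpos : 0 < m := Nat.lt_of_lt_of_le Nat.one_pos ((le_max_right _ _).trans hm)
  obtain ⟨γa, hγa, hA'⟩ := hA ε₀ h0 h1a
  obtain ⟨γs, hγs, hS'⟩ := hm₀ m ((le_max_left _ _).trans hm) 𝔠.b₀ 𝔠.p₀ hb hp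
  refine ⟨min γa γs, lt_min hγa hγs, fun F γ hF hγ hγ₁ => ?_⟩
  have hγa' : γ ≤ γa := hγ₁.trans (min_le_left _ _)
  have hγs' : γ ≤ γs := hγ₁.trans (min_le_right _ _)
  obtain ⟨D, hRep, q₁, σ, C, hq₁, hσ, hC0, hG⟩ := hA' F γ hF hγ hγa' (h𝔠 F hF)
  have hCau : CauchyAtHeights D 𝔠.b₀ 𝔠.p₀ m := hS' F γ hF hγ hγs' D q₁ σ C hq₁ hσ hC0 hG
  exact Summit.QuantumFields.YangMills.Theorems.LogComparisonSocket.stubBody_of_rep_of_cauchy F γ 𝔠.b₀ 𝔠.p₀ ε₀ hmpos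
    D.PintH D.EcstH D.RmH hRep hCau


end Summit.QuantumFields.YangMills.Cruxes.FluctuationComparisonRegPr.Ideate1TwoProfile

end
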